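import Summits.QuantumFields.YangMills.Theorems.BalabanUVNodesN12AtRecord13SepCoPHSocketsPinnedWindow
import Summits.QuantumFields.YangMills.Theorems.BalabanUVNodesN12AtTheta13OfThm1CCMWCubeOfStubs

/-!
# BalabanUVNodes ∕ N12 — THE K0⁷ → K1⁷ JUNCTION AT THE V16 WITNESS WITH N12's SHORTEST LOCATED LIST: the K1⁷ v5 rung body at the door-cured window-edition witness
# `θ₁₅ᶜᶜᴹ(3;γ)(B₃, B₉·B₃, a₀, min a₁ (a₀''∕B₃))`, K-side = V16's stub letters (stubs 1∕2, 3ʷ's conclusion, `4 ≤ F.m`) + the closer's explicit window choice, N12 read at its layer of record `λᴾ`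
# in NODE O's (2.7)-small window — no flow, coupling-step, ε-range, `N₀`, `log`, smallness, proviso, admissibility or sign display left (Track A, DAG node N12 = [B15, Balaban1989LargeFieldI]
# CMP **122** (1989) 175–202; cluster K1 — K1⁷ `StabilityBAtRecordR13SepCoPH` = stmt-QuantumFields-20542, helper; seat `pub-ymgap-dag-n12-d` g14 (R134 s2 «knit at the record»), 2026-08-27; count-neutral,
# CONDITIONAL, NOT a discharge)

HONEST FRAMING.  Count-neutral kernel COMPOSITION BY NAME of this seat's 12Wᵂ-H `…N12AtRecord13SepCoPHSocketsPinnedWindow` §2 (the `_of_inInterval` twin of 12W-H's door-cured ΛΩχZ-pinned socket) at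
dag-n21-c A1ʷ's window-edition family, with: the K1-side input `hP :=` 12Z″ §0 `provisos₁₃SepCoP_theta13OfThm1CCMW_cube_of_prop8TopStep_of_prop6Member_of_betaBoxW` (Bʷ ∘ B′ ∘ A2ʷ ∘ C ∘ dag-n07-e: (8) from
[15] Prop. 8's top step, the (9)-step from Prop. 8 ∧ [6] Prop. 6 at NODE 00's member, the history clauses from stub 3ʷ's box); K0b's residuals `hasResidualsOfRecord_theta13OfNumerics`, admissibility
`admissible_theta13OfNumerics` ∘ A1ʷ `stage12NumericsOfThm1CCMW_pos_of_le_half`, term signs (12Y, same `s2` by `rfl`); `β ≥ 0` along each run's history ⟸ stub 3ʷ's lower box (A2ʷ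
`betaLowerH_theta13OfThm1CCMW_of_half` ∘ dag-n12-e `betaAlongHistory_nonneg_of_betaLowerH` on the run's window `hI`); the (2.7) bound ⟸ stub 3ʷ's upper box (A2ʷ `betaUpperH_theta13OfThm1CCMW_of_half`); NODE O's
`SmallnessFor γ β′ ½ 2 1` ⟸ the explicit window `γ ≤ e⁻³`, `γ²β′ ≤ 1` (12Iᵂ `smallnessFor_half_two_one`); the flow-profile letter `γ·A₀·log γ⁻² ≤ 1∕10` ⟸ `A₀ᶜᶜ¹ ≤ 1∕16` (12Iᵂ §0, K0a); `r = p₀ = M₂ = 1`,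
`M = L³`, `θ.γ = γ` (`rfl`).  The witness letters `B₃' = B₉·B₃`, `a₁' = min a₁ (a₀''∕B₃)` enter as display equations (`subst`).  WHAT IT SHOWS: on V16's road (plan g77: stub 3ˢ∕3ʷ at dag-n21-c Cʷ's
witness; 3ˢ letters → 3ʷ letters by Cʷ's `betaBoxW_of_sign_upper`), the K1⁷ rung body (v5 `stub_nodes13PWS`, N = 2) at the K0⁷ witness needs from the K-side NOTHING beyond the skeleton's stub letters +
`4 ≤ F.m` + the closer's window choice `γ := min γ₀ (min e⁻³ (1+|β′|)⁻¹)` (which gives `γ ≤ e⁻³`, `γ²β′ ≤ 1`, `β′γ² ≤ ¾`), and N12's per-run located inputs below the torus shrink to: live-mass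
(NODE 00), Prop. 1 at `λ.LF P` (dag-n12-c ∕ 12Q⁵), the run's window `Step.InInterval γ (kSel P + 1) g` (inside the K1 world's), the levels `N₀ ≤ N P`, `N₀ ≤ kSel P + 1`, the base situation's residual
NUMBERS (`0 ≤ β ≤ ¼`, `2 ≤ L₀`, `L₀² ≤ L`, `0 ≤ O(1)B₃B₅`, `0 ≤ δ`), print's two p. 200 conditions `hwin`∕`hMl` (reading `M = L³`), `Λ ≠ ∅`, the four ℍ-leaves + (1.80) (N07).  WHICH CHILD BLOCKS
otherwise: N05 `h05S`, N06 `h06`, N07 `h07`, N08 `h08`, N09 `h09`+`h09T`, N10 `h10`, N11 `h11` (S1ᵀ), (UV₁₃) `hUV`, the S-bound world binding, the mixed W-pin `hW ∕ hWdeg`, `hsel`.  Stub 3ʷ's box and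
the sign of β are NODE O's (N12 READS the sign through the coupling step; K0 does not — plan SIGNFREE-WORD); nothing of Bałaban's is asserted; every printed fact is a hypothesis; N12 is NOT discharged;
no node is discharged; K0⁷ ∕ K1⁷ NOT closed; counts unmoved (discharged 5∕27 · Track A 5∕28).  ONE finite four-torus programme at fixed `ε = L^{-K}` — nothing continuum ∕ ℝ⁴ ∕ OS ∕ mass gap ∕
Clay.  No `sorry`, `def`, `instance`, `notation`.

Sources: [Balaban1989LargeFieldI] (0.2)–(0.6) p.176, (1.2) p.178, (1.10)–(1.11) p.179, (1.73) p.192, Prop. 1 (1.78) p.194, (1.80) p.195, (1.89) p.198, (1.91)–(1.102) pp.199–201;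
[Balaban1989LargeFieldII] Thm 1 + (0.1) pp.355–356, (1.4) p.357; [Balaban1988Convergent] (2.1)–(2.9) pp.254–256, (2.17) p.257, Thm 1 p.262, (3.16)–(3.25) pp.268–270; [Balaban1985Variational]
Thm 1 (8)–(9) p.279, (144)–(152) pp.300–301, Prop. 8 p.304; [Balaban1985RegularSpaces] (1.3)–(1.9) p.77, Prop. 6 p.99, (1.130) p.99, Thm 8 p.101; [Balaban1987RG1] Thm 1 p.259, (0.20)–(0.21)
p.256, §1 (1.20)–(1.22) p.264.
-/

noncomputable section

open MeasureTheory
open scoped Matrix.Norms.L2Operator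

namespace Summit.QuantumFields.YangMills.BalabanUVNodes.N12AtTheta13OfThm1CCMWCubeOfStubsWindow

open Literature.MathematicalPhysics.QuantumFieldTheory.Balaban1983to89
open Literature.MathematicalPhysics.QuantumFieldTheory.Balaban1983to89.T4Continuum (T4Family)
open Literature.MathematicalPhysics.QuantumFieldTheory.Balaban1983to89.DagBinding
open Literature.MathematicalPhysics.QuantumFieldTheory.Balaban1983to89.Node00
open FlowStep (BetaLowerH BetaUpperH)
open FlowStepRuns (genFlow)
open B15Claim189Assembly (Setting189 new189 chiPP dom half)
open B15 (Prop1Printed Ineq180)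
open B15.BasicStep (Claim189)
open B15.PrelimIntegrations (Ineq191 Ineq195)
open B15Chi124DetSets (E124)
open B15DeterminingSets (MSField)
open B14DomainGeom (Pt)
open B8Eq17ClassAkV1 (plaqsOf)
open GaugeGroup (dist1)
open GaugeField (plaqHol)
open B15RPrime1100OfRep (rPrimeDataOfSel)
open B15Claim189PrintedConditions (omegaOfChain)
open B15Claim189PinsOfHistory (sitOfHist N0OfRecord₁₃ D189OfHist)
open B15Claim189LambdaPin (enlD)
open B16RLeafRecord13LiveCoPH (laws₁₃CoPH_liveRepin₁₃_of_hasResiduals)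
open Summit.QuantumFields.YangMills.BalabanUVNodes.N12AtRecord13SepCoPHSockets (nodes₁₃CoPH_upS_fourPinW₀_pointed recordS₁₃SepCoPH_of_upS_pinB10YZW₀)

open FlowStep (prefixOf BetaUpperH)
open B14FlowStep (SmallnessFor)

open FlowStep (BetaLowerH)
open B15Claim189N0OfRecord (betaAlongHistory_nonneg_of_betaLowerH)
open Summit.QuantumFields.YangMills.BalabanUVNodes.N12AtTheta13OfThm1CCM (kappa_nonneg_theta13OfThm1CCM E0_nonneg_theta13OfThm1CCM B0_nonneg_theta13OfThm1CCM)
open Summit.QuantumFields.YangMills.BalabanUVNodes.N12AtTheta13OfThm1CCMWCubeOfStubs (provisos₁₃SepCoP_theta13OfThm1CCMW_cube_of_prop8TopStep_of_prop6Member_of_betaBoxW)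
open Summit.QuantumFields.YangMills.BalabanUVNodes.N12AtRecord13SepCoPHSocketsPinnedWindow (nodesAtSomeRecordS₁₃SepCoPH_of_upS_fourPinW₀_pinnedΛΩχZ_ofHistoryBlind_ofCured_liveRepin₁₃_of_massLive_of_hasResiduals_of_inInterval)
open Summit.QuantumFields.YangMills.BalabanUVNodes.N12AtTheta13OfThm1CCMWSmallWindow (gamma_mul_p0Profile_le_tenth smallnessFor_half_two_one)
open Summit.QuantumFields.YangMills.Theorems.K0ROfStepTokensRCube (shrunkCeiling_pos)

variable {F : T4Family}

section Helpers
variable {B₃ B₁ : ℝ}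

/-- `0 < B₃` from stub 1's inhabitation floor `2L² ≤ B₃` (`L ≥ 2`). [cite: Balaban1985Variational, Thm 1 p.279 (bookkeeping)] -/
private theorem floor_pos (hB₃ : 2 * (F.L : ℝ) ^ 2 ≤ B₃) : 0 < B₃ :=
  lt_of_lt_of_le (mul_pos two_pos (pow_pos (by exact_mod_cast lt_trans Nat.zero_lt_one F.hL.2) 2)) hB₃

/-- `0 ≤ B₃` from the floor. [cite: Balaban1985Variational, Thm 1 p.279 (bookkeeping)] -/
private theorem floor_nonneg (hB₃ : 2 * (F.L : ℝ) ^ 2 ≤ B₃) : 0 ≤ B₃ := (floor_pos hB₃).le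

/-- `0 ≤ B₉·B₃` (FILE 29's `b9Of_pos`). [cite: Balaban1985Variational, (9) p.279, (152) p.301 (bookkeeping)] -/
private theorem b9_mul_nonneg (hB₃ : 2 * (F.L : ℝ) ^ 2 ≤ B₃) (hB₁ : 0 ≤ B₁) : 0 ≤ b9Of F (F.L ^ 3) B₁ * B₃ :=
  mul_nonneg (b9Of_pos (F := F) (F.L ^ 3) hB₁).le (floor_nonneg hB₃)

end Helpers

section RungOfStubsWindow
variable (B₃ a₀ a₁ B₁ c₁ B₃' a₁' γ ε₀ ε₂₉ : ℝ) (lam : ResidW F 2) (σ : ∀ P : B12.RunParams, Sit189 F 2 P.K)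
  (s : ∀ P : B12.RunParams, SeqOfRecord F (theta13OfThm1CCMW F 2 3 γ ε₀ ε₂₉ B₃ B₃' a₀ a₁').ν (theta13OfThm1CCMW F 2 3 γ ε₀ ε₂₉ B₃ B₃' a₀ a₁').τ9.M (gOfRecord₁₃ F 2 (theta13OfThm1CCMW F 2 3 γ ε₀ ε₂₉ B₃ B₃' a₀ a₁') P) P.K (lam.kSel P + 1)) (Nm : B12.RunParams → ℕ) (p₁ : ℕ)
  (Mstar : ℕ) (ops : OpsY 2 (theta13OfThm1CCMW F 2 3 γ ε₀ ε₂₉ B₃ B₃' a₀ a₁').toStage3Params Mstar) (ζ : ResidZ F 2) (W₀ : B12.RunParams → PrintedCarriers15) (w : WorldP)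

/-- **★★★★★ THE K0⁷ → K1⁷ JUNCTION AT THE V16 WITNESS WITH N12's SHORTEST LOCATED LIST** — 12Wᵂ-H §2 (the door-cured ΛΩχZ-pinned socket in (2.7)-small-window form) AT the window-edition
witness `Θ := theta13OfNumerics … (stage12NumericsOfThm1CCMW F.L 3 γ ε₀ B₃ B₃' a₀ a₁') …` (₁₃ live re-pin = `θ₁₅ᶜᶜᴹ(3;γ)` by `rfl`; = dag-n21-c Cʷ's large-torus `θ`) with the K1-side input `hP :=` 12Z″ §0 and
EVERY WINDOW-SIDE INPUT DISCHARGED: `β ≥ 0` along each run's history ⟸ stub 3ʷ's lower box (A2ʷ ∘ dag-n12-e `betaAlongHistory_nonneg_of_betaLowerH` on `hI`), the (2.7) bound ⟸ stub 3ʷ's upper box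
(A2ʷ), NODE O's `SmallnessFor γ β′ ½ 2 1` ⟸ `γ ≤ e⁻³`, `γ²β′ ≤ 1` (12Iᵂ `smallnessFor_half_two_one`), the flow-profile letter ⟸ `A₀ᶜᶜ¹ ≤ 1∕16` (12Iᵂ §0, K0a), `r = p₀ = M₂ = 1`, `M = L³`, term signs,
admissibility, K0b's residuals (K0a ∕ 12Y ∕ A1ʷ).  WHAT THE K1⁷ CLOSER OF `stub_nodes13PWS` STILL SUPPLIES on V16's road (the hypothesis list, nothing hidden): K-side = stub 1 `hB₃ ha₀ ha₁ h8`, stub 2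
`hB₁ hc₁ hP6`, stub 3ʷ's conclusion `hγ0 hγh hε hε' hb hβlo hβhi hletter` (+ `0 ≤ β′`), `4 ≤ F.m`, the window choice `γ ≤ e⁻³`, `γ²β′ ≤ 1`; the S-bound world binding `hC hγ hL hup` (`w.γ ≤ γ`); N05 `h05S`,
N06 `h06`, N07 `h07`, N08 `h08`, N09 `h09`+`h09T`, N10 `h10`, N11 `h11`, (UV₁₃) `hUV`; the mixed W-pin `hW ∕ hWdeg` at N12's layer of record `λᴾ` and `hsel`; and PER RUN BELOW THE TORUS only:
live-mass (NODE 00), Prop. 1 at `λ.LF P` (dag-n12-c ∕ 12Q⁵: [15] from stub 1), the run's window `hI` up to `kSel P + 1`, the levels `hNN ∕ hNk`, the base situation's residual numbers `hβ0 hβ hL₀ hL₀L hB hδ`,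
print's p. 200 conditions `hwin ∕ hMl`, `Λ ≠ ∅`, the four ℍ-leaves + (1.80) `L91h L95 L91 L97 L80` (N07).  NO flow, coupling-step, `ε`-range, `hN₀`, `hlog`, `SmallnessFor`, proviso, admissibility or sign
display.  The conclusion IS the registered `NodesAtSomeRecord13PWS F` body (N = 2).  COMPOSITE and CONDITIONAL: every stub letter and node row a HYPOTHESIS; nothing of Bałaban asserted; no node
discharged; K0⁷ ∕ K1⁷ NOT closed; the `F.m ≤ 3` families are the declared residual. [cite: Balaban1989LargeFieldII, Thm 1 p.355, (0.1) pp.355–356, (1.4) p.357, p.391; Balaban1989LargeFieldI, (0.2)–(0.6) p.176, (1.2) p.178, (1.10)–(1.11) p.179, (1.73) p.192, Prop. 1 (1.78) p.194, (1.80) p.195, (1.89) p.198, (1.91)–(1.102) pp.199–201; Balaban1988Convergent, (2.1)–(2.9) pp.254–256, (2.17) p.257, (2.20)–(2.22) p.258, Thm 1 p.262, (3.16)–(3.25) pp.268–270; Balaban1987RG1, Thm 1 p.259, (0.20)–(0.21) p.256, (1.12) p.262, §1 (1.20)–(1.22) p.264; Balaban1985RegularSpaces, (1.3)–(1.6) p.77,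 Prop. 6 p.99, Thm 8 p.101; Balaban1985Variational, Thm 1 (8)–(9) p.279, (152) p.301, Prop. 8 p.304 (bookkeeping)] -/
theorem nodesAtSomeRecordS₁₃SepCoPH_of_upS_fourPinW₀_pinnedΛΩχZ_ofHistoryBlind_ofCured_theta13OfThm1CCMW_cube_of_massLive_of_prop8TopStep_of_prop6Member_of_betaBoxW_of_window
    (hm : 4 ≤ F.m)
    -- stub 1 `stub_prop8StepCoP13`'s letters: [15] Prop. 8's top step at NODE 00's objects (N07's lane; `2L² ≤ B₃` its inhabitation floor)
    (hB₃ : 2 * (F.L : ℝ) ^ 2 ≤ B₃) (ha₀ : 0 < a₀) (ha₁ : 0 < a₁) (h8 : Prop8RegSepTopStep F 2 (fun ν K Ω => suppDomOfRecord F ν K Ω) B₃ a₀ a₁)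
    -- stub 2 `stub_prop6MemberB8At13`'s letters: [6] Prop. 6 at NODE 00's ℤ⁴ cube member (N05∕N06 junction β)
    (hB₁ : 0 ≤ B₁) (hc₁ : 0 < c₁) (hP6 : letI : CStarAlgebra (MatA 2) := {}; B8.Prop6Printed 4 (F.L : ℝ) B₁ c₁ (fun i : B8LeafModelZd.ZdIdx 4 F.L => zdCub (MatA 2) F.L i))
    -- the witness letters (dag-n21-c FILE C ∕ Cʷ): `B₃' = B₉·B₃`, `a₁' = min a₁ (a₀''∕B₃)` — two display equations, `rfl` at the closer
    (hB₃' : B₃' = b9Of F (F.L ^ 3) B₁ * B₃) (ha₁' : a₁' = min a₁ (a0Of F 2 (F.L ^ 3) B₁ c₁ / B₃))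
    -- stub 3ʷ's conclusion at these letters (Cʷ's binders): NODE O's window `0 < γ ≤ ½`, `ε₀ ε₂₉ b β'`, the β-box ON `]0, γ]` of `betaOfRecord₁₃ F 2 θ₁₅ᶜᶜᴹ(3)`, `β'·γ² ≤ ¾`
    (hγ0 : 0 < γ) (hγh : γ ≤ 1 / 2) (hε : 0 < ε₀) (hε' : 0 < ε₂₉) {b β' : ℝ} (hb : 0 ≤ b) (hβlo : BetaLowerH b γ (betaOfRecord₁₃ F 2 (theta13OfThm1CCM F 2 3 ε₀ ε₂₉ B₃ B₃' a₀ a₁')))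
    (hβhi : BetaUpperH β' γ (betaOfRecord₁₃ F 2 (theta13OfThm1CCM F 2 3 ε₀ ε₂₉ B₃ B₃' a₀ a₁'))) (hletter : β' * γ ^ 2 ≤ 3 / 4)
    -- the closer's window choice made (2.7)-small EXPLICITLY (`γ := min γ₀ (min e⁻³ (1+|β'|)⁻¹)` gives both), and the sign of stub 3ʷ's upper constant (from the box)
    (hβ'0 : 0 ≤ β') (hγe : γ ≤ Real.exp (-3)) (hγβ : γ ^ 2 * β' ≤ 1)
    -- the mixed W-pin AT THE LAYER OF RECORD λᴾ: below the torus `W₀ P` IS the bundle of record at λᴾ; elsewhere the closer's leaf-carrying `W₀ P`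
    (hW : ∀ P : B12.RunParams, lam.kSel P < P.K → W₀ P = WOfRecord₁₃ F 2 (theta13OfThm1CCMW F 2 3 γ ε₀ ε₂₉ B₃ B₃' a₀ a₁')
      ((lam.pinRPrime₁₃ (theta13OfThm1CCMW F 2 3 γ ε₀ ε₂₉ B₃ B₃' a₀ a₁')).pinD189ΛH (theta13OfThm1CCMW F 2 3 γ ε₀ ε₂₉ B₃ B₃' a₀ a₁').ν (theta13OfThm1CCMW F 2 3 γ ε₀ ε₂₉ B₃ B₃' a₀ a₁').A₁ (theta13OfThm1CCMW F 2 3 γ ε₀ ε₂₉ B₃ B₃' a₀ a₁').τ9.M (gOfRecord₁₃ F 2 (theta13OfThm1CCMW F 2 3 γ ε₀ ε₂₉ B₃ B₃' a₀ a₁'))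
        (fun P => (((((σ P).pinZres (theta13OfThm1CCMW F 2 3 γ ε₀ ε₂₉ B₃ B₃' a₀ a₁').ν (theta13OfThm1CCMW F 2 3 γ ε₀ ε₂₉ B₃ B₃' a₀ a₁').τ9.M (gOfRecord₁₃ F 2 (theta13OfThm1CCMW F 2 3 γ ε₀ ε₂₉ B₃ B₃' a₀ a₁') P) (s P) (N0OfRecord₁₃ (theta13OfThm1CCMW F 2 3 γ ε₀ ε₂₉ B₃ B₃' a₀ a₁') P (lam.kSel P + 1))).pinSides (theta13OfThm1CCMW F 2 3 γ ε₀ ε₂₉ B₃ B₃' a₀ a₁').ν (gOfRecord₁₃ F 2 (theta13OfThm1CCMW F 2 3 γ ε₀ ε₂₉ B₃ B₃' a₀ a₁') P) (lam.kSel P + 1 - Nm P) (lam.kSel P + 1)).pinXΩ4 (s P) (enlD F (theta13OfThm1CCMW F 2 3 γ ε₀ ε₂₉ B₃ B₃' a₀ a₁').ν (theta13OfThm1CCMW F 2 3 γ ε₀ ε₂₉ B₃ B₃' a₀ a₁').τ9.M P (gOfRecord₁₃ F 2 (theta13OfThm1CCMW F 2 3 γ ε₀ ε₂₉ B₃ B₃'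 a₀ a₁') P))).pinOmegaPP (s P) (Nm P) (enlD F (theta13OfThm1CCMW F 2 3 γ ε₀ ε₂₉ B₃ B₃' a₀ a₁').ν (theta13OfThm1CCMW F 2 3 γ ε₀ ε₂₉ B₃ B₃' a₀ a₁').τ9.M P (gOfRecord₁₃ F 2 (theta13OfThm1CCMW F 2 3 γ ε₀ ε₂₉ B₃ B₃' a₀ a₁') P)))) s Nm p₁) P)
    (hWdeg : ∀ P : B12.RunParams, P.K ≤ lam.kSel P → B15Leaf (W₀ P))
    (hC : w.C = (datumOfRecord₁₃SepCoPH F 2 (Stage13HParams.ofHistoryBlind F 2 (Stage13RParams.ofCured F 2 (theta13OfThm1CCMW F 2 3 γ ε₀ ε₂₉ B₃ B₃' a₀ a₁'))) (provisos₁₃SepCoP_theta13OfThm1CCMW_cube_of_prop8TopStep_of_prop6Member_of_betaBoxW hm hB₃ ha₀ ha₁ h8 hB₁ hc₁ hP6 hB₃' ha₁' hγ0 hγh hε hε' hb hβlo hβhi hletter).ofCured.ofHistoryBlind).C) (hγ : 0 < w.γ ∧ w.γ ≤ (theta13OfThm1CCMW F 2 3 γ ε₀ ε₂₉ B₃ B₃'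 a₀ a₁').γ) (hL : w.L = ((theta13OfThm1CCMW F 2 3 γ ε₀ ε₂₉ B₃ B₃' a₀ a₁').L : ℝ))
    (hup : ∀ P, w.up P = upOfRecord₅CS F 2 ((((((Stage13HParams.ofHistoryBlind F 2 (Stage13RParams.ofCured F 2 (theta13OfThm1CCMW F 2 3 γ ε₀ ε₂₉ B₃ B₃' a₀ a₁'))).toStage5₁₃CoPH F 2).pinB10 F 2).pinY F 2 (Y9OfRecord 2 (theta13OfThm1CCMW F 2 3 γ ε₀ ε₂₉ B₃ B₃' a₀ a₁').toStage3Params Mstar ops)).pinZ F 2 (Z11OfRecord F 2 ζ)).pinW F 2 W₀) P)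
    (h05S : ∀ P : B12.RunParams, (upOfRecord₅CS F 2 ((((((Stage13HParams.ofHistoryBlind F 2 (Stage13RParams.ofCured F 2 (theta13OfThm1CCMW F 2 3 γ ε₀ ε₂₉ B₃ B₃' a₀ a₁'))).toStage5₁₃CoPH F 2).pinB10 F 2).pinY F 2 (Y9OfRecord 2 (theta13OfThm1CCMW F 2 3 γ ε₀ ε₂₉ B₃ B₃' a₀ a₁').toStage3Params Mstar ops)).pinZ F 2 (Z11OfRecord F 2 ζ)).pinW F 2 W₀) P).b8)
    (h06 : B9LeafX (Y9OfRecord 2 (theta13OfThm1CCMW F 2 3 γ ε₀ ε₂₉ B₃ B₃' a₀ a₁').toStage3Params Mstar ops))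
    (h07 : B11Leaf (Z11OfRecord F 2 ζ))
    (h08 : PrintedUV3V 2 (theta13OfThm1CCMW F 2 3 γ ε₀ ε₂₉ B₃ B₃' a₀ a₁').L)
    (h09 : ∀ P : B12.RunParams, B12Sec2to5.Lemma4Printed ((theta13OfThm1CCMW F 2 3 γ ε₀ ε₂₉ B₃ B₃' a₀ a₁').res.X P).F12 ((theta13OfThm1CCMW F 2 3 γ ε₀ ε₂₉ B₃ B₃' a₀ a₁').res.X P).c12)
    (h09T : ∀ P : B12.RunParams, (leavesP w P).smallCouplings → (leavesP w P).smallFieldInductive)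
    (h10 : ∀ P : B12.RunParams, B9LeafX (Y9OfRecord 2 (theta13OfThm1CCMW F 2 3 γ ε₀ ε₂₉ B₃ B₃' a₀ a₁').toStage3Params Mstar ops) →
      (B10.Thm1PrintedCompact (((((((Stage13HParams.ofHistoryBlind F 2 (Stage13RParams.ofCured F 2 (theta13OfThm1CCMW F 2 3 γ ε₀ ε₂₉ B₃ B₃' a₀ a₁'))).toStage5₁₃CoPH F 2).pinB10 F 2).pinY F 2 (Y9OfRecord 2 (theta13OfThm1CCMW F 2 3 γ ε₀ ε₂₉ B₃ B₃' a₀ a₁').toStage3Params Mstar ops)).pinZ F 2 (Z11OfRecord F 2 ζ)).pinW F 2 W₀).res.X P).runs10 ∧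
          B10.Thm2Printed (((((((Stage13HParams.ofHistoryBlind F 2 (Stage13RParams.ofCured F 2 (theta13OfThm1CCMW F 2 3 γ ε₀ ε₂₉ B₃ B₃' a₀ a₁'))).toStage5₁₃CoPH F 2).pinB10 F 2).pinY F 2 (Y9OfRecord 2 (theta13OfThm1CCMW F 2 3 γ ε₀ ε₂₉ B₃ B₃' a₀ a₁').toStage3Params Mstar ops)).pinZ F 2 (Z11OfRecord F 2 ζ)).pinW F 2 W₀).res.X P).runs10) →
        B11Leaf (Z11OfRecord F 2 ζ) → B12Sec2to5.Lemma4Printed ((theta13OfThm1CCMW F 2 3 γ ε₀ ε₂₉ B₃ B₃' a₀ a₁').res.X P).F12 ((theta13OfThm1CCMW F 2 3 γ ε₀ ε₂₉ B₃ B₃' a₀ a₁').res.X P).c12 →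
          B13.Lemma1Printed ((theta13OfThm1CCMW F 2 3 γ ε₀ ε₂₉ B₃ B₃' a₀ a₁').res.X P).S13 ((theta13OfThm1CCMW F 2 3 γ ε₀ ε₂₉ B₃ B₃' a₀ a₁').res.X P).c13 ∧ B13.Lemma2Printed ((theta13OfThm1CCMW F 2 3 γ ε₀ ε₂₉ B₃ B₃' a₀ a₁').res.X P).S13 ((theta13OfThm1CCMW F 2 3 γ ε₀ ε₂₉ B₃ B₃' a₀ a₁').res.X P).c13 ∧
            B13.Lemma3Printed ((theta13OfThm1CCMW F 2 3 γ ε₀ ε₂₉ B₃ B₃' a₀ a₁').res.X P).S13 ((theta13OfThm1CCMW F 2 3 γ ε₀ ε₂₉ B₃ B₃' a₀ a₁').res.X P).c13)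
    (h11 : ∀ P : B12.RunParams, (leavesP w P).b7 → (leavesP w P).b8 → (leavesP w P).b9 → (leavesP w P).b10 → (leavesP w P).b11 →
      (leavesP w P).smallCouplings → (leavesP w P).smallFieldInductive → (leavesP w P).flowControl →
        ∀ k, k < P.K → SLaw₁₃CoPH F 2 (Stage13HParams.ofHistoryBlind F 2 (Stage13RParams.ofCured F 2 (theta13OfThm1CCMW F 2 3 γ ε₀ ε₂₉ B₃ B₃' a₀ a₁'))) P k → TLaw₁₃CoPH F 2 (Stage13HParams.ofHistoryBlind F 2 (Stage13RParams.ofCured F 2 (theta13OfThm1CCMW F 2 3 γ ε₀ ε₂₉ B₃ B₃' a₀ a₁'))) P k)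
    (hUV : ∀ P : B12.RunParams, (genFlow (betaOfRecord₁₃ F 2 (theta13OfThm1CCMW F 2 3 γ ε₀ ε₂₉ B₃ B₃' a₀ a₁')) P.g0).InInterval w.γ P.K → ∀ k, k ≤ P.K → SLaw₁₃CoPH F 2 (Stage13HParams.ofHistoryBlind F 2 (Stage13RParams.ofCured F 2 (theta13OfThm1CCMW F 2 3 γ ε₀ ε₂₉ B₃ B₃' a₀ a₁'))) P k →
      ∀ U : GaugeField (F.P P.K) k (SU 2),
        chiβOfRecord₁₃ F 2 (theta13OfThm1CCMW F 2 3 γ ε₀ ε₂₉ B₃ B₃' a₀ a₁') P.K (gOfRecord₁₃ F 2 (theta13OfThm1CCMW F 2 3 γ ε₀ ε₂₉ B₃ B₃' a₀ a₁') P) k U *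
              Real.exp (-(1 / (gOfRecord₁₃ F 2 (theta13OfThm1CCMW F 2 3 γ ε₀ ε₂₉ B₃ B₃' a₀ a₁') P k) ^ 2 * wilsonBGOfRecord F 2 (theta13OfThm1CCMW F 2 3 γ ε₀ ε₂₉ B₃ B₃' a₀ a₁').εbg P k U)
                - w.em (gOfRecord₁₃ F 2 (theta13OfThm1CCMW F 2 3 γ ε₀ ε₂₉ B₃ B₃' a₀ a₁') P k) * (Fintype.card (Site (F.P P.K) k) : ℝ)) ≤ densOfRecord₁₃ F 2 (theta13OfThm1CCMW F 2 3 γ ε₀ ε₂₉ B₃ B₃' a₀ a₁') P k U ∧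
        densOfRecord₁₃ F 2 (theta13OfThm1CCMW F 2 3 γ ε₀ ε₂₉ B₃ B₃' a₀ a₁') P k U ≤ Real.exp (w.ep (gOfRecord₁₃ F 2 (theta13OfThm1CCMW F 2 3 γ ε₀ ε₂₉ B₃ B₃' a₀ a₁') P k) * (Fintype.card (Site (F.P P.K) k) : ℝ)))
    -- N12 AT THE LAYER OF RECORD IN NODE O's (2.7)-SMALL WINDOW: 12Pᵂ's located per-run inputs, run by run, BELOW THE TORUS ONLY (`D P` abbreviates the pinned (1.89) setting `λᴾ.D189 P`)
    (D : ∀ P : B12.RunParams, Setting189 (F.P P.K) (SU 2) (MSField (F.P P.K) (SU 2) × ((j : ℕ) → VecField (F.P P.K) j (EuclideanSpace ℝ (Fin (2 ^ 2 - 1))))) (Pt (F.P P.K).d))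
    (hD : ∀ P : B12.RunParams, D P = ((lam.pinRPrime₁₃ (theta13OfThm1CCMW F 2 3 γ ε₀ ε₂₉ B₃ B₃' a₀ a₁')).pinD189ΛH (theta13OfThm1CCMW F 2 3 γ ε₀ ε₂₉ B₃ B₃' a₀ a₁').ν (theta13OfThm1CCMW F 2 3 γ ε₀ ε₂₉ B₃ B₃' a₀ a₁').A₁ (theta13OfThm1CCMW F 2 3 γ ε₀ ε₂₉ B₃ B₃' a₀ a₁').τ9.M (gOfRecord₁₃ F 2 (theta13OfThm1CCMW F 2 3 γ ε₀ ε₂₉ B₃ B₃' a₀ a₁')) (fun P => (((((σ P).pinZres (theta13OfThm1CCMW F 2 3 γ ε₀ ε₂₉ B₃ B₃' a₀ a₁').ν (theta13OfThm1CCMW F 2 3 γ ε₀ ε₂₉ B₃ B₃' a₀ a₁').τ9.M (gOfRecord₁₃ F 2 (theta13OfThm1CCMW F 2 3 γ ε₀ ε₂₉ B₃ B₃' a₀ a₁') P) (s P) (N0OfRecord₁₃ (theta13OfThm1CCMW F 2 3 γ ε₀ ε₂₉ B₃ B₃' a₀ a₁') P (lam.kSel P + 1))).pinSides (theta13OfThm1CCMW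 F 2 3 γ ε₀ ε₂₉ B₃ B₃' a₀ a₁').ν (gOfRecord₁₃ F 2 (theta13OfThm1CCMW F 2 3 γ ε₀ ε₂₉ B₃ B₃' a₀ a₁') P) (lam.kSel P + 1 - Nm P) (lam.kSel P + 1)).pinXΩ4 (s P) (enlD F (theta13OfThm1CCMW F 2 3 γ ε₀ ε₂₉ B₃ B₃' a₀ a₁').ν (theta13OfThm1CCMW F 2 3 γ ε₀ ε₂₉ B₃ B₃' a₀ a₁').τ9.M P (gOfRecord₁₃ F 2 (theta13OfThm1CCMW F 2 3 γ ε₀ ε₂₉ B₃ B₃' a₀ a₁') P))).pinOmegaPP (s P) (Nm P) (enlD F (theta13OfThm1CCMW F 2 3 γ ε₀ ε₂₉ B₃ B₃' a₀ a₁').ν (theta13OfThm1CCMW F 2 3 γ ε₀ ε₂₉ B₃ B₃' a₀ a₁').τ9.M P (gOfRecord₁₃ F 2 (theta13OfThm1CCMW F 2 3 γ ε₀ ε₂₉ B₃ B₃' a₀ a₁') P)))) s Nm p₁).D189 P)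
    (hmassLive : ∀ P : B12.RunParams, lam.kSel P < P.K → ∀ a, LiveSeq F 2 (theta13OfThm1CCMW F 2 3 γ ε₀ ε₂₉ B₃ B₃' a₀ a₁').ν (theta13OfThm1CCMW F 2 3 γ ε₀ ε₂₉ B₃ B₃' a₀ a₁').τ9 P (gOfRecord₁₃ F 2 (theta13OfThm1CCMW F 2 3 γ ε₀ ε₂₉ B₃ B₃' a₀ a₁') P) (lam.kSel P + 1)
        (slotsTOfRecord F 2 (theta13OfThm1CCMW F 2 3 γ ε₀ ε₂₉ B₃ B₃' a₀ a₁').ν (theta13OfThm1CCMW F 2 3 γ ε₀ ε₂₉ B₃ B₃' a₀ a₁').τ9 (EOfRecord₁₃ F 2 (theta13OfThm1CCMW F 2 3 γ ε₀ ε₂₉ B₃ B₃' a₀ a₁')) (wOfRecord₉ F 2 (theta13OfThm1CCMW F 2 3 γ ε₀ ε₂₉ B₃ B₃' a₀ a₁').toStage9Params)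
          (theta13OfThm1CCMW F 2 3 γ ε₀ ε₂₉ B₃ B₃' a₀ a₁').ppSel P (gOfRecord₁₃ F 2 (theta13OfThm1CCMW F 2 3 γ ε₀ ε₂₉ B₃ B₃' a₀ a₁') P) (lam.kSel P + 1)) a →
      0 < ∫ V, rterm (reprTOfRecord₁₃ F 2 (theta13OfThm1CCMW F 2 3 γ ε₀ ε₂₉ B₃ B₃' a₀ a₁') P (lam.kSel P)) a V ∂(fieldMeasure (F.P P.K) (lam.kSel P + 1) (SU 2)))
    (hP1 : ∀ P : B12.RunParams, lam.kSel P < P.K → Prop1Printed (lam.LF P))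
    (hNN : ∀ P : B12.RunParams, lam.kSel P < P.K → N0OfRecord₁₃ (theta13OfThm1CCMW F 2 3 γ ε₀ ε₂₉ B₃ B₃' a₀ a₁') P (lam.kSel P + 1) ≤ Nm P)
    (hNk : ∀ P : B12.RunParams, lam.kSel P < P.K → N0OfRecord₁₃ (theta13OfThm1CCMW F 2 3 γ ε₀ ε₂₉ B₃ B₃' a₀ a₁') P (lam.kSel P + 1) ≤ lam.kSel P + 1)
    (hβ0 : ∀ P : B12.RunParams, lam.kSel P < P.K → 0 ≤ (σ P).β)
    (hβ : ∀ P : B12.RunParams, lam.kSel P < P.K → (σ P).β ≤ 1 / 4)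
    (hL₀ : ∀ P : B12.RunParams, lam.kSel P < P.K → 2 ≤ (σ P).L₀)
    (hL₀L : ∀ P : B12.RunParams, lam.kSel P < P.K → (σ P).L₀ ^ 2 ≤ ((F.P P.K).L : ℝ))
    (hB : ∀ P : B12.RunParams, lam.kSel P < P.K → 0 ≤ (σ P).O1 * (σ P).B₃ * (σ P).B₅)
    (hδ : ∀ P : B12.RunParams, lam.kSel P < P.K → 0 ≤ (σ P).δ)
    (hwin : ∀ P : B12.RunParams, lam.kSel P < P.K → 4 * (2 + (121 / 120) ^ 2 * ((σ P).O1 * (σ P).B₃ * (σ P).B₅ * ((theta13OfThm1CCMW F 2 3 γ ε₀ ε₂₉ B₃ B₃' a₀ a₁').τ9.M : ℝ) ^ 5))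
      ≤ ((Real.log ((gOfRecord₁₃ F 2 (theta13OfThm1CCMW F 2 3 γ ε₀ ε₂₉ B₃ B₃' a₀ a₁') P) (lam.kSel P + 1) ^ 2)⁻¹) ^ (theta13OfThm1CCMW F 2 3 γ ε₀ ε₂₉ B₃ B₃' a₀ a₁').ν.r) ^ (Real.log ((σ P).L₀ ^ 2) / Real.log ((F.P P.K).L : ℝ)))
    (hMl : ∀ P : B12.RunParams, lam.kSel P < P.K → (121 / 120) ^ 2 * ((σ P).O1 * (σ P).B₃ * (σ P).B₅ * ((theta13OfThm1CCMW F 2 3 γ ε₀ ε₂₉ B₃ B₃' a₀ a₁').τ9.M : ℝ) ^ 5) * Real.exp (-(4 * (σ P).δ * ((theta13OfThm1CCMW F 2 3 γ ε₀ ε₂₉ B₃ B₃' a₀ a₁').τ9.M : ℝ))) ≤ 1 / 12)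
    (hI : ∀ P : B12.RunParams, lam.kSel P < P.K → Step.InInterval (theta13OfThm1CCMW F 2 3 γ ε₀ ε₂₉ B₃ B₃' a₀ a₁').γ (lam.kSel P + 1) (gOfRecord₁₃ F 2 (theta13OfThm1CCMW F 2 3 γ ε₀ ε₂₉ B₃ B₃' a₀ a₁') P))
    (hΛ : ∀ P : B12.RunParams, lam.kSel P < P.K → (((enlD F (theta13OfThm1CCMW F 2 3 γ ε₀ ε₂₉ B₃ B₃' a₀ a₁').ν (theta13OfThm1CCMW F 2 3 γ ε₀ ε₂₉ B₃ B₃' a₀ a₁').τ9.M P (gOfRecord₁₃ F 2 (theta13OfThm1CCMW F 2 3 γ ε₀ ε₂₉ B₃ B₃' a₀ a₁') P)) 4 (lam.kSel P + 1 + 1 - (N0OfRecord₁₃ (theta13OfThm1CCMW F 2 3 γ ε₀ ε₂₉ B₃ B₃' a₀ a₁') P (lam.kSel P + 1)))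
        (omegaOfChain (s P) (lam.kSel P + 1 + 1 - (N0OfRecord₁₃ (theta13OfThm1CCMW F 2 3 γ ε₀ ε₂₉ B₃ B₃' a₀ a₁') P (lam.kSel P + 1)))))ᶜ ∩ (σ P).Z).Nonempty)
    (L91h : ∀ P : B12.RunParams, lam.kSel P < P.K → ∀ U, new189 (D P) U → ∀ p ∈ plaqsOf (half (D P)),
      Ineq191 (dist1 (plaqHol ((D P).Upp U) p)) ((D P).devV'' U p) (D P).α (((D P).L ^ (D P).h)⁻¹) ((D P).ε (D P).h) (E124 (D P).ε (D P).L (D P).η (D P).k (D P).h))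
    (L95 : ∀ P : B12.RunParams, lam.kSel P < P.K → ∀ U, new189 (D P) U → ∀ p ∈ plaqsOf (half (D P)),
      Ineq195 ((D P).devV'' U p) (dist1 (plaqHol ((D P).Uhalf U ((D P).boxOf p)) p)) (D P).α (((D P).L ^ (D P).h)⁻¹) ((D P).ε (D P).h) (E124 (D P).ε (D P).L (D P).η (D P).k (D P).h))
    (L91 : ∀ P : B12.RunParams, lam.kSel P < P.K → ∀ U, new189 (D P) U → ∀ j, (D P).h ≤ j → j ≤ (D P).k → ∀ p ∈ plaqsOf (dom (D P) j),
      Ineq191 (dist1 (plaqHol ((D P).Upp U) p)) ((D P).dev97 U p) (D P).α (((D P).L ^ j)⁻¹) ((D P).ε j) (E124 (D P).ε (D P).L (D P).η (D P).k j))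
    (L97 : ∀ P : B12.RunParams, lam.kSel P < P.K → ∀ U, new189 (D P) U → ∀ j, (D P).h ≤ j → j ≤ (D P).k → ∀ p ∈ plaqsOf (dom (D P) j),
      Ineq191 ((D P).dev97 U p) ((D P).dev0 U p) (D P).α (((D P).L ^ j)⁻¹) ((D P).ε j) (E124 (D P).ε (D P).L (D P).η (D P).k j))
    (L80 : ∀ P : B12.RunParams, lam.kSel P < P.K → ∀ U, new189 (D P) U → ∀ j, (D P).h ≤ j → j ≤ (D P).k → ∀ p ∈ plaqsOf (dom (D P) j),
      Ineq180 ((D P).dev0 U p) ((D P).ε (D P).k) (D P).η (D P).B₃ (D P).B₅ (D P).M (D P).δ ((D P).dist p) (D P).O1)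
    (hsel : ∀ P : B12.RunParams, 1 ≤ P.K → lam.kSel P < P.K) :
    ∃ (θ' : Stage13HParams F 2) (h' : θ'.Provisos₁₃SepCoPH F 2) (w : WorldP), (θ'.ZhUnity F 2 ∧ θ'.SlotsNondegenerate₁₃ F 2) ∧ θ'.Admissible F 2 ∧
      (∃ (θ'' : Stage13HParams F 2) (h'' : θ''.Provisos₁₃SepCoPH F 2), θ''.Admissible F 2 ∧
        datumOfRecord₁₃SepCoPH F 2 θ' h' = datumOfRecord₁₃SepCoPH F 2 θ'' h'' ∧ w.C = (datumOfRecord₁₃SepCoPH F 2 θ' h').C ∧ (0 < w.γ ∧ w.γ ≤ θ''.γ) ∧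
        w.L = (θ''.L : ℝ) ∧ ∀ P : B12.RunParams, w.up P = upOfRecord₅CS F 2 (θ''.toStage5₁₃CoPH F 2) P) ∧
      (∀ P : B12.RunParams, Nodes (leavesP w P)) ∧ PrintedUV3V 2 θ'.L ∧
      ∃ lam : ResidW F 2, (∀ P : B12.RunParams, 1 ≤ P.K → lam.kSel P < P.K) ∧
        ∀ P : B12.RunParams, lam.kSel P < P.K → ((leavesP w P).rBasicStep ↔ B15Leaf (WOfRecord₁₃ F 2 θ'.toStage13Params lam P)) := by
  subst hB₃' ha₁'
  -- the witness's `A₀ = A₀ᶜᶜ¹(L, B₃, B₉B₃, a₀, a₁') ∈ [0, 1∕16]` (K0a) for the flow-profile letter (12Iᵂ §0); `r = p₀ = M₂ = 1`, `M = L³`, `θ.γ = γ` by `rfl`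
  have hA : 0 ≤ A0OfThm1CC1 F.L B₃ (b9Of F (F.L ^ 3) B₁ * B₃) a₀ (min a₁ (a0Of F 2 (F.L ^ 3) B₁ c₁ / B₃)) :=
    A0OfThm1CC1_nonneg (floor_nonneg hB₃) (b9_mul_nonneg hB₃ hB₁) ha₀.le (shrunkCeiling_pos F (F.L ^ 3) (floor_pos hB₃) hB₁ hc₁ ha₁).le
  have hA' : A0OfThm1CC1 F.L B₃ (b9Of F (F.L ^ 3) B₁ * B₃) a₀ (min a₁ (a0Of F 2 (F.L ^ 3) B₁ c₁ / B₃)) ≤ 1 / 16 :=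
    (A0OfThm1CC1_le (floor_nonneg hB₃) (b9_mul_nonneg hB₃ hB₁) ha₀.le (shrunkCeiling_pos F (F.L ^ 3) (floor_pos hB₃) hB₁ hc₁ ha₁).le).trans (A0OfThm1C_le_sixteenth (floor_nonneg hB₃))
  exact nodesAtSomeRecordS₁₃SepCoPH_of_upS_fourPinW₀_pinnedΛΩχZ_ofHistoryBlind_ofCured_liveRepin₁₃_of_massLive_of_hasResiduals_of_inInterval
    (theta13OfNumerics F 2 (stage12NumericsOfThm1CCMW F.L 3 γ ε₀ B₃ (b9Of F (F.L ^ 3) B₁ * B₃) a₀ (min a₁ (a0Of F 2 (F.L ^ 3) B₁ c₁ / B₃))) ε₂₉ (zeta316OfRecord F 2 (stage12NumericsOfThm1CCMW F.L 3 γ ε₀ B₃ (b9Of F (F.L ^ 3) B₁ * B₃) a₀ (min a₁ (a0Of F 2 (F.L ^ 3) B₁ c₁ / B₃))).ν (stage12NumericsOfThm1CCMW F.L 3 γ ε₀ B₃ (b9Of F (F.L ^ 3) B₁ * B₃) a₀ (min a₁ (a0Of F 2 (F.L ^ 3) B₁ c₁ / B₃))).τ9.M (stage12NumericsOfThm1CCMW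 F.L 3 γ ε₀ B₃ (b9Of F (F.L ^ 3) B₁ * B₃) a₀ (min a₁ (a0Of F 2 (F.L ^ 3) B₁ c₁ / B₃))).A₁) (RzOfRecord F 2) (ZtOfRecord F 2)) lam σ s Nm p₁ Mstar ops ζ W₀ w
    (hasResidualsOfRecord_theta13OfNumerics F 2 (stage12NumericsOfThm1CCMW F.L 3 γ ε₀ B₃ (b9Of F (F.L ^ 3) B₁ * B₃) a₀ (min a₁ (a0Of F 2 (F.L ^ 3) B₁ c₁ / B₃))) ε₂₉)
    (provisos₁₃SepCoP_theta13OfThm1CCMW_cube_of_prop8TopStep_of_prop6Member_of_betaBoxW hm hB₃ ha₀ ha₁ h8 hB₁ hc₁ hP6 rfl rfl hγ0 hγh hε hε' hb hβlo hβhi hletter)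
    (admissible_theta13OfNumerics F 2 (zeta316OfRecord F 2 (stage12NumericsOfThm1CCMW F.L 3 γ ε₀ B₃ (b9Of F (F.L ^ 3) B₁ * B₃) a₀ (min a₁ (a0Of F 2 (F.L ^ 3) B₁ c₁ / B₃))).ν (stage12NumericsOfThm1CCMW F.L 3 γ ε₀ B₃ (b9Of F (F.L ^ 3) B₁ * B₃) a₀ (min a₁ (a0Of F 2 (F.L ^ 3) B₁ c₁ / B₃))).τ9.M (stage12NumericsOfThm1CCMW F.L 3 γ ε₀ B₃ (b9Of F (F.L ^ 3) B₁ * B₃) a₀ (min a₁ (a0Of F 2 (F.L ^ 3) B₁ c₁ / B₃))).A₁) (RzOfRecord F 2) (ZtOfRecord F 2) (stage12NumericsOfThm1CCMW_pos_of_le_half F.hL.2.le hγ0 hγh hε (floor_nonneg hB₃) (b9_mul_nonneg hB₃ hB₁) ha₀ (shrunkCeiling_pos F (F.L ^ 3) (floor_pos hB₃) hB₁ hc₁ ha₁)) hε')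
    (kappa_nonneg_theta13OfThm1CCM F 2 3 ε₀ ε₂₉ B₃ (b9Of F (F.L ^ 3) B₁ * B₃) a₀ (min a₁ (a0Of F 2 (F.L ^ 3) B₁ c₁ / B₃))) (E0_nonneg_theta13OfThm1CCM F 2 3 ε₀ ε₂₉ B₃ (b9Of F (F.L ^ 3) B₁ * B₃) a₀ (min a₁ (a0Of F 2 (F.L ^ 3) B₁ c₁ / B₃))) (B0_nonneg_theta13OfThm1CCM F 2 3 ε₀ ε₂₉ B₃ (b9Of F (F.L ^ 3) B₁ * B₃) a₀ (min a₁ (a0Of F 2 (F.L ^ 3) B₁ c₁ / B₃)))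
    hW hWdeg hC hγ hL hup h05S h06 h07 h08 h09 h09T h10 h11 hUV
    Nat.one_pos -- `M₂ = 1`
    (pow_pos (Nat.zero_lt_of_lt F.hL.2) 3) -- `M = L³ > 0`
    D hD hmassLive hP1 le_rfl hNN hNk hβ0 hβ hL₀ hL₀L hB hδ hwin
    (fun P hk => betaAlongHistory_nonneg_of_betaLowerH hb (betaLowerH_theta13OfThm1CCMW_of_half hγh hβlo) (hI P hk)) -- `β ≥ 0` along the history ⟸ 3ʷ's lower box
    hMl hA (smallnessFor_half_two_one hγ0 hγe hβ'0 hγβ) (by norm_num) (gamma_mul_p0Profile_le_tenth hγ0 hγh hA hA')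
    (betaUpperH_theta13OfThm1CCMW_of_half hγh hβhi) -- the (2.7) bound ⟸ 3ʷ's upper box
    hI hΛ L91h L95 L91 L97 L80 hsel

end RungOfStubsWindow

end Summit.QuantumFields.YangMills.BalabanUVNodes.N12AtTheta13OfThm1CCMWCubeOfStubsWindow
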